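import Summits.BirchSwinnertonDyer.BirchSwinnertonDyer.Theorems.ThetaPartnerAtTwoSignedKatoUpToAtTwoCoreOfCharValues
import HarnessLib

/-!
# Route `ThetaPartnerAtTwo` (TP2), crux K3 `SignedKatoDivisibilityUpToAtTwo` (item stmt-BirchSwinnertonDyer-20308) /
# K3P′ (stmt-BirchSwinnertonDyer-25631), line `colemanrat` v12 — the character-value socket ON THE LAYER PAIRING (col₀-free):
# CORE_χ ⟸ CORE_pairχ

Width seat `bsd-wall-tp2-p2x-w3` g6 (cell `bsd-wall`). HONEST FRAMING: one implication between fully spelled statements (no definition, no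
named fact, no instance, no `sorry`); closes no item; K3 / K3P′ are NOT settled and BSD is NOT proved by any of this.

## What is here

Skeleton v12 registers the PUB stub `stub_katoLayerErlTwo` = CORE_pair (hypothesis `hpair` of w2 g5's `CoreFin.core_of_corePair`): the explicit
reciprocity law stated ON THE LAYER PAIRING functional `pair n (I.proj n s) : E(ℚ_{n,v}) →+ ℤ₂` — no tower glue `col₀`. The lead's memo v4.1 asks
for the character-value socket in the same col₀-free currency ("v13 := w3 g6's character-value form IF it is stated on the layer pairing").
This file: **`coreChi_of_corePairChi : CORE_pairχ → CORE_χ`**, CORE_pairχ := CORE_pair with (ERL_pair) REPLACED by (ERL_pairχ):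
«`∃ μ ν ∈ Λ ∖ 𝔭 ∀ n ∀ χ` (even, `2`-power order, mod `2^{n+2}`):
`ν(χ(γ)−1) · P_{n,d_n}(pair n (I.proj n s))(χ(γ)−1) = μ(χ(γ)−1) · ratTwistedSymbolSum f χ`» (values in `ℂ₂`; `P(ζ−1) = ∑_{j<2ⁿ} ⟨pair_n s_n, gʲ d_n⟩ ζʲ =
χ(P_{n,d_n}(s_n))`). Proof: for a glue `col₀` the tower and layer pairing sums coincide (as in `CoreFin.pairingSum_tower_eq_layer`).
Chain for a v13 registration: `CoreFin.core_of_coreFin ∘ CoreChi.core_fin_of_coreChi ∘ coreChi_of_corePairChi : CORE_pairχ → CORE`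
(all Theorems-side, route-independent); K3P′ by name: `signedKatoDivisibilityUpToAtTwoOfPub_of_coreChi ∘ coreChi_of_corePairChi`
(`…CoreOfCharValuesLiterature.lean`). Sequel `…CorePairPrimitiveCharValues.lean`: primitive characters suffice on the layer pairing.

References: [Kato2004Asterisque] Thm. 12.5 (1) (pp. 221–222); [Kobayashi2003] (8.23), Thm. 6.3 (proof, p. 25); [Sprung2012] Def. 3.1 (p. 1489);
[MazurTateTeitelbaum1986Invent] §I.13.
-/

set_option autoImplicit false
-- the Theorems namespace of this sub repeats the summit name by design (D-0017 nested layout)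
set_option linter.dupNamespace false

noncomputable section

open scoped Classical MatrixGroups ModularForm NumberField

open CongruenceSubgroup WeierstrassCurve Field IsDedekindDomain NumberField Polynomial
  Literature.NumberTheory.GaloisRepresentations
  Literature.NumberTheory.EllipticCurves Literature.NumberTheory.EllipticCurves.ModularForms
  Literature.NumberTheory.EllipticCurves.Module Literature.NumberTheory.EllipticCurves.Rank1Residual
  Literature.NumberTheory.EllipticCurves.Kobayashi2003 Literature.NumberTheory.EllipticCurves.Kato2004
  Literature.NumberTheory.EllipticCurves.Kato2004.EulerSystemValues Literature.NumberTheory.EllipticCurves.GreenbergSelmer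
  Literature.NumberTheory.EllipticCurves.Sprung2012 Literature.NumberTheory.EllipticCurves.Sprung2017
  ZpExtension Summit.BirchSwinnertonDyer.Rank1Residual.Supersingular

namespace Summit.BirchSwinnertonDyer.BirchSwinnertonDyer.Theorems.SignedKatoOffTwo.CoreChi

/-! ## §8 CORE_χ ⟸ CORE_pairχ (col₀-free character-value socket) -/

/-- **CORE_χ ⟸ CORE_pairχ.** Hypothesis CORE_pairχ: v12's registered PUB stub `stub_katoLayerErlTwo` (= CORE_pair = `hpair` of
`CoreFin.core_of_corePair`) with its congruence clause (ERL_pair) REPLACED by the character-value law (ERL_pairχ) on THE layer pairing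
functional `pair n (I.proj n s)`: for every layer `n` and every even Dirichlet character `χ` modulo `2^{n+2}` of `2`-power order,
`ν(χ(γ)−1) · χ(P_{n,d_n}(pair n (I.proj n s))) = μ(χ(γ)−1) · ∑_a χ(a)[a/2^{n+2}]⁺_f` (Kato Thm. 12.5 (1) / 6.6 + 9.7 and Birch, character by
character; `γ = 5`). Conclusion: CORE_χ (hypothesis of `core_fin_of_coreChi`) VERBATIM — for any tower glue `col₀` of `pair` along `I.proj`,
`P_{n,d_n}(col₀ s) = P_{n,d_n}(pair n (I.proj n s))` termwise (`evalOn_of_mem` + the glue identity). CONDITIONAL on the hypothesis only; closes nothing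
by itself. [cite: Kato2004Asterisque, Thm. 12.5 (1) (pp. 221–222)] [cite: Kobayashi2003, (8.23), Thm. 6.3 (proof, p. 25)] [cite: Sprung2012, Def. 3.1 (p. 1489)] -/
theorem coreChi_of_corePairChi
    (hpc :
      ∀ (v : HeightOneSpectrum (𝓞 ℚ)), ((2 : ℕ) : 𝓞 ℚ) ∈ v.asIdeal →
      ∀ (W : WeierstrassCurve ℚ) [W.IsElliptic] [W.IsGloballyMinimal],
        ¬ W.HasCM → W.analyticRank = 0 → GoodSS W 2 → W.frobeniusTrace 2 = 0 →
        ∀ (κ : ZpExtension ℚ 2) (γ : Field.absoluteGaloisGroup ℚ) (hκ : κ.IsCyclotomic),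
          κ.IsTopGenerator γ → IsCyclotomicVariable 2 γ →
          ∀ [NeZero (W.conductorNorm ℤ)] (f : CuspForm (Gamma0 (W.conductorNorm ℤ)) 2),
            IsNewformOf W f → ∀ (ϖ : ℚ), (ϖ : ℝ) * W.realPeriodRat = plusPeriod f →
          ∀ (Lplus Lminus : IwasawaAlgebra 2), IsPollackPair f 2 Lplus Lminus →
          ∀ [ContinuousSMul ℤ_[2] (W.tateModule 2)] [Module.Free ℤ_[2] (W.tateModule 2)]
            [Module.Finite ℤ_[2] (W.tateModule 2)],
          ∀ 𝔭 : PrimeSpectrum (IwasawaAlgebra 2), 𝔭.asIdeal.height = 1 →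
            PowerSeries.C (2 : ℤ_[2]) ∉ 𝔭.asIdeal →
          ∀ (I : Kato2004.IwasawaH1Data W 2 κ γ)
            (pair : ∀ n : ℕ, H1 (tateRep W 2) (κ.layerSubgroup n) →ₗ[ℤ_[2]]
              (localLayerPointsOfEmb κ (closureEmb (K := ℚ) (v.adicCompletion ℚ)) W n →+ ℤ_[2])),
            -- (P1) projection formula
            (∀ (n : ℕ) (x : H1 (tateRep W 2) (κ.layerSubgroup (n + 1))) (Q : localPoints W (v.adicCompletion ℚ))
              (hQ : Q ∈ localLayerPointsOfEmb κ (closureEmb (K := ℚ) (v.adicCompletion ℚ)) W n),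
              pair n (layerCores (tateRep W 2) κ n x) ⟨Q, hQ⟩ =
                pair (n + 1) x ⟨Q, localLayerPointsOfEmb_mono κ (closureEmb (K := ℚ) (v.adicCompletion ℚ)) W (Nat.le_succ n) hQ⟩) →
            -- (P2) Galois invariance, for EVERY `g ∈ Γ_v`
            (∀ (n : ℕ) (g : absoluteGaloisGroup (v.adicCompletion ℚ)) (y : H1 (tateRep W 2) (κ.layerSubgroup n))
              (Q : localPoints W (v.adicCompletion ℚ))
              (hQ : Q ∈ localLayerPointsOfEmb κ (closureEmb (K := ℚ) (v.adicCompletion ℚ)) W n),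
              pair n (conjMap (tateRep W 2).toTopRep (κ.layerSubgroup n) (resGalOfEmb (closureEmb (K := ℚ) (v.adicCompletion ℚ)) g) 1 y)
                ⟨g • Q, smul_mem_localLayerPointsOfEmb κ (closureEmb (K := ℚ) (v.adicCompletion ℚ)) W n g hQ⟩ = pair n y ⟨Q, hQ⟩) →
            -- (P3) `pair` IS the `T₂E`-adic local Tate pairing: residues = the (D-layer) pairings for THE Weil pairings of the tree
            (∀ (n k : ℕ) (x : H1 (tateRep W 2) (κ.layerSubgroup n))
              (Q : localLayerPointsOfEmb κ (closureEmb (K := ℚ) (v.adicCompletion ℚ)) W n),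
              PadicInt.toZModPow k (pair n x Q) =
                LayerPairing.layerPairingPk W κ v (LayerPairing.weilTowerPk W) (LayerPairing.weilTowerPk_pow W)
                  (LayerPairing.weilTowerPk_add_left W) (LayerPairing.weilTowerPk_add_right W) (LayerPairing.weilTowerPk_smul W)
                  n k x Q) →
          ∃ (g : absoluteGaloisGroup (v.adicCompletion ℚ))
            (_ : κ.IsTopGenerator (resGalOfEmb (closureEmb (K := ℚ) (v.adicCompletion ℚ)) g))
            (d : ℕ → localPoints W (v.adicCompletion ℚ)) (s : I.H),
            (∀ n, d n ∈ localLayerPointsOfEmb κ (closureEmb (K := ℚ) (v.adicCompletion ℚ)) W n) ∧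
            (∀ n, localTraceOfEmb κ (closureEmb (K := ℚ) (v.adicCompletion ℚ)) W (n + 1) (n + 2) (d (n + 2)) = -d n) ∧
            (∀ n : ℕ, 1 ≤ n → ∀ P ∈ localLayerPointsOfEmb κ (closureEmb (K := ℚ) (v.adicCompletion ℚ)) W n,
              ∃ B ∈ AddSubgroup.closure (Set.range fun σ : absoluteGaloisGroup (v.adicCompletion ℚ) ↦ σ • d n),
                ∃ P' ∈ localLayerPointsOfEmb κ (closureEmb (K := ℚ) (v.adicCompletion ℚ)) W (n - 1),
                ∃ R ∈ localLayerPointsOfEmb κ (closureEmb (K := ℚ) (v.adicCompletion ℚ)) W n, P = B + P' + 2 • R) ∧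
            (∀ P ∈ localLayerPointsOfEmb κ (closureEmb (K := ℚ) (v.adicCompletion ℚ)) W 0,
              ∃ a : ℤ, ∃ R ∈ localLayerPointsOfEmb κ (closureEmb (K := ℚ) (v.adicCompletion ℚ)) W 0, P = a • d 0 + 2 • R) ∧
            Kato2004.IsEulerSystemClassTwo W hκ I s ∧
            ∃ μ ν : IwasawaAlgebra 2, μ ∉ 𝔭.asIdeal ∧ ν ∉ 𝔭.asIdeal ∧
              ∀ (n : ℕ) (χ : DirichletCharacter ℂ_[2] (2 ^ (n + cyclotomicExponent 2))),
                χ.Even → (∃ j : ℕ, orderOf χ = 2 ^ j) →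
                (∑' k, ((algebraMap ℚ_[2] ℂ_[2]).comp (algebraMap ℤ_[2] ℚ_[2])) (PowerSeries.coeff k ν) *
                    (χ (cyclotomicGenerator 2 : ZMod (2 ^ (n + cyclotomicExponent 2))) - 1) ^ k) *
                  (∑' k, ((algebraMap ℚ_[2] ℂ_[2]).comp (algebraMap ℤ_[2] ℚ_[2]))
                      (PowerSeries.coeff k (pairingSum W (localLayerPointsOfEmb κ (closureEmb (K := ℚ) (v.adicCompletion ℚ)) W n)
                        g n (d n) (pair n (I.proj n s)))) *
                    (χ (cyclotomicGenerator 2 : ZMod (2 ^ (n + cyclotomicExponent 2))) - 1) ^ k) =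
                (∑' k, ((algebraMap ℚ_[2] ℂ_[2]).comp (algebraMap ℤ_[2] ℚ_[2])) (PowerSeries.coeff k μ) *
                    (χ (cyclotomicGenerator 2 : ZMod (2 ^ (n + cyclotomicExponent 2))) - 1) ^ k) *
                  ratTwistedSymbolSum f χ) :
    ∀ (v : HeightOneSpectrum (𝓞 ℚ)), ((2 : ℕ) : 𝓞 ℚ) ∈ v.asIdeal →
      ∀ (W : WeierstrassCurve ℚ) [W.IsElliptic] [W.IsGloballyMinimal],
        ¬ W.HasCM → W.analyticRank = 0 → GoodSS W 2 → W.frobeniusTrace 2 = 0 →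
        ∀ (κ : ZpExtension ℚ 2) (γ : Field.absoluteGaloisGroup ℚ) (hκ : κ.IsCyclotomic),
          κ.IsTopGenerator γ → IsCyclotomicVariable 2 γ →
          ∀ [NeZero (W.conductorNorm ℤ)] (f : CuspForm (Gamma0 (W.conductorNorm ℤ)) 2),
            IsNewformOf W f → ∀ (ϖ : ℚ), (ϖ : ℝ) * W.realPeriodRat = plusPeriod f →
          ∀ (Lplus Lminus : IwasawaAlgebra 2), IsPollackPair f 2 Lplus Lminus →
          ∀ [ContinuousSMul ℤ_[2] (W.tateModule 2)] [Module.Free ℤ_[2] (W.tateModule 2)]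
            [Module.Finite ℤ_[2] (W.tateModule 2)],
          ∀ 𝔭 : PrimeSpectrum (IwasawaAlgebra 2), 𝔭.asIdeal.height = 1 →
            PowerSeries.C (2 : ℤ_[2]) ∉ 𝔭.asIdeal →
          ∀ (I : Kato2004.IwasawaH1Data W 2 κ γ)
            (pair : ∀ n : ℕ, H1 (tateRep W 2) (κ.layerSubgroup n) →ₗ[ℤ_[2]]
              (localLayerPointsOfEmb κ (closureEmb (K := ℚ) (v.adicCompletion ℚ)) W n →+ ℤ_[2])),
            -- (P1) projection formula
            (∀ (n : ℕ) (x : H1 (tateRep W 2) (κ.layerSubgroup (n + 1))) (Q : localPoints W (v.adicCompletion ℚ))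
              (hQ : Q ∈ localLayerPointsOfEmb κ (closureEmb (K := ℚ) (v.adicCompletion ℚ)) W n),
              pair n (layerCores (tateRep W 2) κ n x) ⟨Q, hQ⟩ =
                pair (n + 1) x ⟨Q, localLayerPointsOfEmb_mono κ (closureEmb (K := ℚ) (v.adicCompletion ℚ)) W (Nat.le_succ n) hQ⟩) →
            -- (P2) Galois invariance, for EVERY `g ∈ Γ_v`
            (∀ (n : ℕ) (g : absoluteGaloisGroup (v.adicCompletion ℚ)) (y : H1 (tateRep W 2) (κ.layerSubgroup n))
              (Q : localPoints W (v.adicCompletion ℚ))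
              (hQ : Q ∈ localLayerPointsOfEmb κ (closureEmb (K := ℚ) (v.adicCompletion ℚ)) W n),
              pair n (conjMap (tateRep W 2).toTopRep (κ.layerSubgroup n) (resGalOfEmb (closureEmb (K := ℚ) (v.adicCompletion ℚ)) g) 1 y)
                ⟨g • Q, smul_mem_localLayerPointsOfEmb κ (closureEmb (K := ℚ) (v.adicCompletion ℚ)) W n g hQ⟩ = pair n y ⟨Q, hQ⟩) →
            -- (P3) `pair` IS the `T₂E`-adic local Tate pairing: residues = the (D-layer) pairings for THE Weil pairings of the tree
            (∀ (n k : ℕ) (x : H1 (tateRep W 2) (κ.layerSubgroup n))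
              (Q : localLayerPointsOfEmb κ (closureEmb (K := ℚ) (v.adicCompletion ℚ)) W n),
              PadicInt.toZModPow k (pair n x Q) =
                LayerPairing.layerPairingPk W κ v (LayerPairing.weilTowerPk W) (LayerPairing.weilTowerPk_pow W)
                  (LayerPairing.weilTowerPk_add_left W) (LayerPairing.weilTowerPk_add_right W) (LayerPairing.weilTowerPk_smul W)
                  n k x Q) →
          ∃ (g : absoluteGaloisGroup (v.adicCompletion ℚ))
            (_ : κ.IsTopGenerator (resGalOfEmb (closureEmb (K := ℚ) (v.adicCompletion ℚ)) g))
            (d : ℕ → localPoints W (v.adicCompletion ℚ)) (s : I.H),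
            (∀ n, d n ∈ localLayerPointsOfEmb κ (closureEmb (K := ℚ) (v.adicCompletion ℚ)) W n) ∧
            (∀ n, localTraceOfEmb κ (closureEmb (K := ℚ) (v.adicCompletion ℚ)) W (n + 1) (n + 2) (d (n + 2)) = -d n) ∧
            (∀ n : ℕ, 1 ≤ n → ∀ P ∈ localLayerPointsOfEmb κ (closureEmb (K := ℚ) (v.adicCompletion ℚ)) W n,
              ∃ B ∈ AddSubgroup.closure (Set.range fun σ : absoluteGaloisGroup (v.adicCompletion ℚ) ↦ σ • d n),
                ∃ P' ∈ localLayerPointsOfEmb κ (closureEmb (K := ℚ) (v.adicCompletion ℚ)) W (n - 1),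
                ∃ R ∈ localLayerPointsOfEmb κ (closureEmb (K := ℚ) (v.adicCompletion ℚ)) W n, P = B + P' + 2 • R) ∧
            (∀ P ∈ localLayerPointsOfEmb κ (closureEmb (K := ℚ) (v.adicCompletion ℚ)) W 0,
              ∃ a : ℤ, ∃ R ∈ localLayerPointsOfEmb κ (closureEmb (K := ℚ) (v.adicCompletion ℚ)) W 0, P = a • d 0 + 2 • R) ∧
            Kato2004.IsEulerSystemClassTwo W hκ I s ∧
            (∀ col₀ : I.H →+ (localTowerPointsOfEmb κ (closureEmb (K := ℚ) (v.adicCompletion ℚ)) W →+ ℤ_[2]),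
              (∀ (n : ℕ) (x : I.H) (Q : localPoints W (v.adicCompletion ℚ)) (hQ : Q ∈ localLayerPointsOfEmb κ (closureEmb (K := ℚ) (v.adicCompletion ℚ)) W n),
                col₀ x ⟨Q, localLayerPointsOfEmb_le_localTowerPointsOfEmb κ (closureEmb (K := ℚ) (v.adicCompletion ℚ)) W n hQ⟩ = pair n (I.proj n x) ⟨Q, hQ⟩) →
              ∃ μ ν : IwasawaAlgebra 2, μ ∉ 𝔭.asIdeal ∧ ν ∉ 𝔭.asIdeal ∧
                ∀ (n : ℕ) (χ : DirichletCharacter ℂ_[2] (2 ^ (n + cyclotomicExponent 2))),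
                  χ.Even → (∃ j : ℕ, orderOf χ = 2 ^ j) →
                  (∑' k, ((algebraMap ℚ_[2] ℂ_[2]).comp (algebraMap ℤ_[2] ℚ_[2])) (PowerSeries.coeff k ν) *
                      (χ (cyclotomicGenerator 2 : ZMod (2 ^ (n + cyclotomicExponent 2))) - 1) ^ k) *
                    (∑' k, ((algebraMap ℚ_[2] ℂ_[2]).comp (algebraMap ℤ_[2] ℚ_[2]))
                        (PowerSeries.coeff k (pairingSum W (localTowerPointsOfEmb κ (closureEmb (K := ℚ) (v.adicCompletion ℚ)) W)
                          g n (d n) (col₀ s))) *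
                      (χ (cyclotomicGenerator 2 : ZMod (2 ^ (n + cyclotomicExponent 2))) - 1) ^ k) =
                  (∑' k, ((algebraMap ℚ_[2] ℂ_[2]).comp (algebraMap ℤ_[2] ℚ_[2])) (PowerSeries.coeff k μ) *
                      (χ (cyclotomicGenerator 2 : ZMod (2 ^ (n + cyclotomicExponent 2))) - 1) ^ k) *
                    ratTwistedSymbolSum f χ) := by
  intro v hv W _ _ hcm hr hss ha κ γ hκ hγ hvar _ f hf ϖ hϖ Lplus Lminus hPol _ _ _ 𝔭 h𝔭 h2 I pair hP1 hP2 hP3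
  obtain ⟨g, hg, d, s, hL, hTR, hGEN, hGEN0, hES, μ, ν, hμ, hν, hval⟩ :=
    hpc v hv W hcm hr hss ha κ γ hκ hγ hvar f hf ϖ hϖ Lplus Lminus hPol 𝔭 h𝔭 h2 I pair hP1 hP2 hP3
  refine ⟨g, hg, d, s, hL, hTR, hGEN, hGEN0, hES, fun col₀ hglue ↦ ⟨μ, ν, hμ, hν, fun n χ hev hord ↦ ?_⟩⟩
  -- the tower pairing sum of `col₀ s` IS the layer pairing sum of `pair n (I.proj n s)`
  have hPS : pairingSum W (localTowerPointsOfEmb κ (closureEmb (K := ℚ) (v.adicCompletion ℚ)) W) g n (d n) (col₀ s) =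
      pairingSum W (localLayerPointsOfEmb κ (closureEmb (K := ℚ) (v.adicCompletion ℚ)) W n) g n (d n) (pair n (I.proj n s)) := by
    rw [pairingSum_def, pairingSum_def]
    refine Finset.sum_congr rfl fun j _ ↦ ?_
    have hj : g ^ j • d n ∈ localLayerPointsOfEmb κ (closureEmb (K := ℚ) (v.adicCompletion ℚ)) W n :=
      smul_mem_localLayerPointsOfEmb κ (closureEmb (K := ℚ) (v.adicCompletion ℚ)) W n (g ^ j) (hL n)
    rw [evalOn_of_mem W _ _ (localLayerPointsOfEmb_le_localTowerPointsOfEmb κ (closureEmb (K := ℚ) (v.adicCompletion ℚ)) W n hj),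
      evalOn_of_mem W _ _ hj, hglue n s (g ^ j • d n) hj]
  rw [hPS]
  exact hval n χ hev hord

end Summit.BirchSwinnertonDyer.BirchSwinnertonDyer.Theorems.SignedKatoOffTwo.CoreChi

end
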